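import Summits.HodgeConjecture.CorCM.SexticOcticWeilFrameTransfer
import Summits.HodgeConjecture.CorCM.Census.SexticOcticWeilExtraction
import Summits.HodgeConjecture.CorCM.DecicWeil23PairTenfoldParts
import Summits.HodgeConjecture.CorCM.OcticWeil13PairEightfoldParts
import Summits.HodgeConjecture.CorCM.CMWeightPushforwardExtraction
import HarnessLib

/-!
# COR-CM — `E × T × B` over a sextic and an octic CM field sharing `k`: the EIGHTFOLD parts (`τ̄`, the three labels of `T` of sign `b`, the
# four labels of `B` of sign `¬b` — the Weil weight of `Ē × T × B̄`) have algebraic lines, GIVEN the four and six parts of `X⁺ = E ⊞ E ⊞ X`,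
# by PUSH–PULL through two fresh curves

Cell `pub-hodgecm2` (COR-CM), seat b30 gen 26 (2026-08-23); count-neutral own lane SEXTIC-OCTIC.  Theorems only; no definition, no named
fact, no `sorry`.  The two-degree twin of gen 24's `CorCM/DecicWeil23MultiTenfoldParts.lean`: for `X = ⨁_j A(κ j)` put TWO fresh curve slots in
front, `X⁺ = ⨁_l A(ext₂ κ l)` (gen 22's `DecicWeil23Pair.ext₂ κ = (0, 0, κ)` BY NAME, so that `ext₂ κ (j+2)` is DEFINITIONALLY `κ j`), and let
`G = {x₀} ⊔ G₁ ⊔ G₂` be an eight part of sign `b` (`x₀` over `τ_{¬b}`, `G₁` a three part of sign `b`, `G₂` a quad part of sign `¬b`).  With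
`T = {(0, τ_b), (1, τ_{¬b})}`: `σ G ⊔ T = (σ G₁ ⊔ {(0, τ_b)}) ⊔ (σ G₂ ⊔ {σ x₀, (1, τ_{¬b})})` is a disjoint union of a FOUR part of sign `b`
(the Weil weight of `T × E`) and a SIX part of sign `¬b` (the Weil weight of `B̄ × Ē × Ē`) of `X⁺` — algebraic by the hypotheses `hfour`, `hsix`
(discharged downstream from Markman's fourfold and hyperbolic-sixfold theorems) — and the complementary weight `T' = {(0, τ_{¬b}), (1, τ_b)}` is
a conjugate PAIR of curve coordinates (a divisor line).  The push-forward extraction lemma (P1, gen 21: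
`CMWeights.weightClassesAlg_le_algebraicClasses_of_pushforward`) then gives the line of `G` on `X` (codimension `4`).

* **`weightClassesAlg_le_algebraicClasses_of_isEightPartS`** — THE LEMMA.
HONEST FRAMING: nothing about the Hodge conjecture is concluded in this file; `HC_CM` is not asserted.
[cite: Schoen1998HodgeWeilAddendum, §10] [cite: Milne2020HodgeClassesAV, 1.2 (a) and Thm. 1] [cite: MoonenZarhin1995Duke, Thm. 2.4]
[cite: Gordon1999HodgeAVSurvey, 9.2.2]

## References
* [Schoen1998HodgeWeilAddendum] C. Schoen, Compositio Math. 114 (1998), §10.  [Milne2020HodgeClassesAV] J. S. Milne, arXiv:2010.08857,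
  1.2 (a), Thm. 1.  [MoonenZarhin1995Duke] B. Moonen, Yu. Zarhin, Duke Math. J. 77 (1995), Thm. 2.4.  [Gordon1999HodgeAVSurvey] B. B.
  Gordon, CRM Monogr. 10 (1999), 9.2.2.
-/

noncomputable section

open CategoryTheory CategoryTheory.Limits NumberField

namespace Summit.HodgeConjecture.CorCM.SexticOcticWeil

open Literature.AlgebraicGeometry Literature.AlgebraicGeometry.Motives Literature.AlgebraicGeometry.HodgeTheory
open Literature.AlgebraicGeometry.ComplexMultiplication (IsCMTypeRealisation)
open Literature.AlgebraicGeometry.Pohlmann1968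
open Literature.NumberTheory.ComplexMultiplication
open Summit.HodgeConjecture.CorCM.Census.SexticOcticWeil (PtS cjS cjS_inl IsPairPartS IsThreePartS IsQuadPartS IsFourPartS IsSixPartS
  IsEightPartS)
open Summit.HodgeConjecture.CorCM.DecicWeil23Pair (ext₂ succ₂_injective eq_of_not_mem_range_succ₂ not_mem_range_succ₂)
open Summit.HodgeConjecture.CorCM.CMWeights (weightClassesAlg_le_algebraicClasses_of_pushforward sigma_map_injective)
open Summit.HodgeConjecture.CorCM.PairWeights (weightClassesAlg_union_le_algebraicClasses)
open Summit.HodgeConjecture.CorCM.OcticWeil13Pair (decide_tauSign_eq exists_eq_tauSign tauSign_not_ne)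

open scoped Classical

section Eightfold

variable {I : Type} {Kf : I → Type} [∀ i, Field (Kf i)] [∀ i, NumberField (Kf i)] [∀ i, IsCMField (Kf i)]
  {i₀ i₁ i₂ : I} {N : ℕ} (κ : Fin N → Fin 3) {e₁ : (Kf i₁ →+* ℂ) ≃ Fin 3 × Bool} {e₂ : (Kf i₂ →+* ℂ) ≃ Fin 4 × Bool}
  {τ : Kf i₀ →+* ℂ} (hττ : ComplexEmbedding.conjugate τ ≠ τ) (hk : ∀ σ : Kf i₀ →+* ℂ, σ = τ ∨ σ = ComplexEmbedding.conjugate τ)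
  (he₁_conj : ∀ s : Kf i₁ →+* ℂ, e₁ (ComplexEmbedding.conjugate s) = ((e₁ s).1, !(e₁ s).2))
  (he₂_conj : ∀ t : Kf i₂ →+* ℂ, e₂ (ComplexEmbedding.conjugate t) = ((e₂ t).1, !(e₂ t).2))
  {A : Fin 3 → AbelianVariety ℂ} {Φ : ∀ j : Fin 3, CMType (Kf (soSlots i₀ i₁ i₂ j))}
  {ι : ∀ j, 𝓞 (Kf (soSlots i₀ i₁ i₂ j)) →+* End (A j)}
  {θ : ∀ j, Kf (soSlots i₀ i₁ i₂ j) →+* Module.End ℂ (complexBetti (A j).X 1)}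
  (hA : ∀ j, IsCMTypeRealisation (Φ j) (A j) (ι j) (θ j))

include hττ hk he₁_conj he₂_conj hA in
/-- **THE EIGHTFOLD PART LEMMA.**  Let `X = ⨁_j A(κ j)` be a product of copies of `E, T, B` and `G` an eight part of sign `b` of a weight of
`X` (one point over `τ_{¬b}`, one over each `(1, a, b)`, one over each `(2, a, ¬b)`).  IF on `X⁺ = E ⊞ E ⊞ X = ⨁_l A(ext₂ κ l)` every four part
and every six part has an algebraic line (`hfour`, `hsix`), THEN the line of `G` on `X` is algebraic (codimension `4`): push-pull through the
two fresh curves (module docstring). [cite: Schoen1998HodgeWeilAddendum, §10] [cite: Milne2020HodgeClassesAV, 1.2 (a) and Thm. 1]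
[cite: MoonenZarhin1995Duke, Thm. 2.4] -/
theorem weightClassesAlg_le_algebraicClasses_of_isEightPartS
    (hfour : ∀ (c : Bool) (G' : Finset ((l : Fin (N + 2)) × (Kf (soSlots i₀ i₁ i₂ (ext₂ κ l)) →+* ℂ))),
      IsFourPartS (fun x => toPtS e₁ e₂ τ ((Sigma.map (ext₂ κ) (fun _ => id) :
        ((l : Fin (N + 2)) × (Kf (soSlots i₀ i₁ i₂ (ext₂ κ l)) →+* ℂ)) → ((m : Fin 3) × (Kf (soSlots i₀ i₁ i₂ m) →+* ℂ))) x)) c G' →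
        weightClassesAlg (fun l => A (ext₂ κ l)) (fun l => ι (ext₂ κ l)) (2 * 2) G' ≤ algebraicClasses (⨁ fun l => A (ext₂ κ l)).X 2)
    (hsix : ∀ (c : Bool) (G' : Finset ((l : Fin (N + 2)) × (Kf (soSlots i₀ i₁ i₂ (ext₂ κ l)) →+* ℂ))),
      IsSixPartS (fun x => toPtS e₁ e₂ τ ((Sigma.map (ext₂ κ) (fun _ => id) :
        ((l : Fin (N + 2)) × (Kf (soSlots i₀ i₁ i₂ (ext₂ κ l)) →+* ℂ)) → ((m : Fin 3) × (Kf (soSlots i₀ i₁ i₂ m) →+* ℂ))) x)) c G' →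
        weightClassesAlg (fun l => A (ext₂ κ l)) (fun l => ι (ext₂ κ l)) (2 * 3) G' ≤ algebraicClasses (⨁ fun l => A (ext₂ κ l)).X 3)
    {b : Bool} {G : Finset ((j : Fin N) × (Kf (soSlots i₀ i₁ i₂ (κ j)) →+* ℂ))}
    (hG : IsEightPartS (fun x => toPtS e₁ e₂ τ ((Sigma.map κ (fun _ => id) :
      ((j : Fin N) × (Kf (soSlots i₀ i₁ i₂ (κ j)) →+* ℂ)) → ((m : Fin 3) × (Kf (soSlots i₀ i₁ i₂ m) →+* ℂ))) x)) b G) :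
    G.card = 2 * 4 ∧ weightClassesAlg (fun j => A (κ j)) (fun j => ι (κ j)) (2 * 4) G ≤
      algebraicClasses (⨁ fun j => A (κ j)).X 4 := by
  have hGcard : G.card = 2 * 4 := by rw [hG.1]
  refine ⟨hGcard, ?_⟩
  -- ### notation: the two index sets, the model maps, the embedding `e₂'`
  let IX := (j : Fin N) × (Kf (soSlots i₀ i₁ i₂ (κ j)) →+* ℂ)
  let IP := (l : Fin (N + 2)) × (Kf (soSlots i₀ i₁ i₂ (ext₂ κ l)) →+* ℂ)
  let v : IX → PtS := fun x => toPtS e₁ e₂ τ ((Sigma.map κ (fun _ => id) :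
    IX → ((m : Fin 3) × (Kf (soSlots i₀ i₁ i₂ m) →+* ℂ))) x)
  let vP : IP → PtS := fun x => toPtS e₁ e₂ τ ((Sigma.map (ext₂ κ) (fun _ => id) :
    IP → ((m : Fin 3) × (Kf (soSlots i₀ i₁ i₂ m) →+* ℂ))) x)
  let e₂' : Fin N → Fin (N + 2) := fun j => j.succ.succ
  have he₂' : Function.Injective e₂' := succ₂_injective
  let σ₂ : IX ↪ IP := ⟨_, sigma_map_injective (K := fun l => Kf (soSlots i₀ i₁ i₂ (ext₂ κ l))) e₂' he₂'⟩
  have hvσ : ∀ x : IX, vP (σ₂ x) = v x := fun x => rfl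
  have hσfst : ∀ x : IX, 2 ≤ ((σ₂ x).1 : ℕ) := fun x => by
    change 2 ≤ ((x.1.succ.succ : Fin (N + 2)) : ℕ)
    simp only [Fin.val_succ]; omega
  have hAP : ∀ l, IsCMTypeRealisation (Φ (ext₂ κ l)) (A (ext₂ κ l)) (ι (ext₂ κ l)) (θ (ext₂ κ l)) := fun l => hA (ext₂ κ l)
  -- ### the fresh curve coordinates
  let τs : Bool → (Kf i₀ →+* ℂ) := fun c => if c then τ else ComplexEmbedding.conjugate τ
  have hτs : ∀ c, decide (τs c = τ) = c := fun c => decide_tauSign_eq hττ c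
  have hτs_ne : ∀ c, τs (!c) ≠ τs c := fun c => tauSign_not_ne hττ c
  let p0 : Bool → IP := fun c => ⟨0, τs c⟩
  let p1 : Bool → IP := fun c => ⟨1, τs c⟩
  have hv0 : ∀ c, vP (p0 c) = Sum.inl c := fun c => by
    change toPtS (i₁ := i₁) (i₂ := i₂) e₁ e₂ τ ⟨0, τs c⟩ = _; rw [toPtS_zero, hτs]
  have hv1 : ∀ c, vP (p1 c) = Sum.inl c := fun c => by
    change toPtS (i₁ := i₁) (i₂ := i₂) e₁ e₂ τ ⟨0, τs c⟩ = _; rw [toPtS_zero, hτs]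
  have hfst0 : ∀ c, ((p0 c).1 : ℕ) = 0 := fun c => rfl
  have hfst1 : ∀ c, ((p1 c).1 : ℕ) = 1 := fun c => rfl
  -- every coordinate of a fresh slot is one of the four points
  have hfresh : ∀ x : IP, x.1 ∉ Set.range e₂' → ∃ c, x = p0 c ∨ x = p1 c := by
    rintro ⟨l, σ⟩ hl
    rcases eq_of_not_mem_range_succ₂ hl with rfl | rfl
    · obtain ⟨c, hc⟩ := exists_eq_tauSign hk σ; exact ⟨c, Or.inl (by rw [hc])⟩
    · obtain ⟨c, hc⟩ := exists_eq_tauSign hk σ; exact ⟨c, Or.inr (by rw [hc])⟩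
  -- ### the weights `T = {p0 b, p1 ¬b}` and `T' = {p0 ¬b, p1 b}`
  have hne01 : ∀ c c', p0 c ≠ p1 c' := fun c c' h => by
    have := congrArg (fun x : IP => (x.1 : ℕ)) h; simp [hfst0, hfst1] at this
  have hne00 : p0 (!b) ≠ p0 b := fun h => hτs_ne b (eq_of_heq (Sigma.mk.inj_iff.1 h).2)
  have hne11 : p1 (!b) ≠ p1 b := fun h => hτs_ne b (eq_of_heq (Sigma.mk.inj_iff.1 h).2)
  set T : Finset IP := {p0 b, p1 (!b)} with hT
  set T' : Finset IP := {p0 (!b), p1 b} with hT'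
  have hTcard : T.card = 2 * 1 := Finset.card_pair (hne01 b (!b))
  have hT'card : T'.card = 2 * 1 := Finset.card_pair (hne01 (!b) b)
  have hmemT : ∀ x, x ∈ T ↔ x = p0 b ∨ x = p1 (!b) := fun x => by
    simp only [hT, Finset.mem_insert, Finset.mem_singleton]
  have hmemT' : ∀ x, x ∈ T' ↔ x = p0 (!b) ∨ x = p1 b := fun x => by
    simp only [hT', Finset.mem_insert, Finset.mem_singleton]
  have hTT' : Disjoint T T' := by
    rw [Finset.disjoint_left]
    intro x hx hx'
    rw [hmemT] at hx
    rw [hmemT'] at hx'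
    rcases hx with rfl | rfl <;> rcases hx' with h | h
    exacts [hne00 h.symm, hne01 _ _ h, (hne01 _ _ h.symm).elim, hne11 h]
  -- `T ⊔ T'` = all coordinates off the old slots
  have hfreshT : ∀ x : IP, (x ∈ T ∨ x ∈ T') → x.1 ∉ Set.range e₂' := by
    intro x hx
    apply not_mem_range_succ₂
    rcases hx with hx | hx
    · rw [hmemT] at hx
      rcases hx with rfl | rfl
      · rw [hfst0]; norm_num
      · rw [hfst1]; norm_num
    · rw [hmemT'] at hx
      rcases hx with rfl | rfl
      · rw [hfst0]; norm_num
      · rw [hfst1]; norm_num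
  have hcov : ∀ x : IP, (x ∈ T ∨ x ∈ T') ↔ x.1 ∉ Set.range e₂' := by
    intro x
    refine ⟨hfreshT x, fun hx => ?_⟩
    obtain ⟨c, hc⟩ := hfresh x hx
    rw [hmemT, hmemT']
    by_cases hcb : c = b
    · subst hcb
      rcases hc with h | h
      · exact Or.inl (Or.inl h)
      · exact Or.inr (Or.inr h)
    · have hcb' : c = !b := by cases c <;> cases b <;> simp_all
      subst hcb'
      rcases hc with h | h
      · exact Or.inr (Or.inl h)
      · exact Or.inl (Or.inr h)
  -- ### `T'` is one conjugate pair of curve coordinates: algebraic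
  have halg₂ : weightClassesAlg (fun l => A (ext₂ κ l)) (fun l => ι (ext₂ κ l)) (2 * 1) T' ≤
      algebraicClasses (⨁ fun l => A (ext₂ κ l)).X 1 := by
    refine (weightClassesAlg_le_algebraicClasses_of_isPairPartS (ext₂ κ) hττ hk he₁_conj he₂_conj hA ⟨Sum.inl (!b),
      hT'card, ?_, ?_⟩).2
    · intro z hz z' hz' h
      simp only [hT', Finset.coe_insert, Finset.coe_singleton, Set.mem_insert_iff, Set.mem_singleton_iff] at hz hz'
      rcases hz with rfl | rfl <;> rcases hz' with rfl | rfl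
      · rfl
      · exact absurd ((hv0 (!b)).symm.trans (h.trans (hv1 b))) (by cases b <;> simp)
      · exact absurd ((hv1 b).symm.trans (h.trans (hv0 (!b)))) (by cases b <;> simp)
      · rfl
    · rw [hT', Finset.image_insert, Finset.image_singleton, cjS_inl, Bool.not_not]
      change ({vP (p0 (!b)), vP (p1 b)} : Finset PtS) = _
      rw [hv0, hv1]
  -- ### `σ G ⊔ T` is a four part ⊔ a six part: algebraic
  obtain ⟨x₀, G₁, G₂, hx₁, hx₂, hG₁₂, hGU, hvx₀, hW₁, hW₂⟩ := hG.exists_split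
  -- the four part `σ G₁ ⊔ {p0 b}`
  have hd₁ : Disjoint (G₁.map σ₂) {p0 b} := by
    rw [Finset.disjoint_singleton_right]
    intro hz
    obtain ⟨w, -, hw⟩ := Finset.mem_map.1 hz
    have h2 := hσfst w
    rw [hw] at h2; exact absurd h2 (by rw [hfst0]; omega)
  have hS₁ : IsFourPartS vP b (G₁.map σ₂ ∪ {p0 b}) := by
    refine ⟨?_, ?_, fun a => ?_⟩
    · rw [Finset.card_union_of_disjoint hd₁, Finset.card_map, hW₁.1, Finset.card_singleton]
    · have hF : ∀ z ∈ G₁.map σ₂, ¬ vP z = Sum.inl b := fun z hz => by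
        obtain ⟨w, hw, rfl⟩ := Finset.mem_map.1 hz
        obtain ⟨a, ha⟩ := hW₁.exists_eq hw
        change vP (σ₂ w) ≠ _
        rw [hvσ, show v w = Sum.inr (Sum.inl (a, b)) from ha]
        exact Sum.inr_ne_inl
      rw [Finset.filter_union, Finset.filter_false_of_mem hF, Finset.empty_union,
        Finset.filter_true_of_mem (fun z hz => by rw [Finset.mem_singleton.1 hz]; exact hv0 b), Finset.card_singleton]
    · have hF : ∀ z ∈ ({p0 b} : Finset IP), ¬ vP z = Sum.inr (Sum.inl (a, b)) := fun z hz => by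
        rw [Finset.mem_singleton.1 hz, show vP (p0 b) = _ from hv0 b]; exact Sum.inl_ne_inr
      rw [Finset.filter_union, Finset.filter_false_of_mem hF, Finset.union_empty, Finset.filter_map, Finset.card_map, ← hW₁.2 a]
      exact congrArg Finset.card (Finset.filter_congr fun w _ => by rw [Function.comp_apply, hvσ])
  -- the six part `σ G₂ ⊔ {σ x₀, p1 ¬b}`
  have hx₀p1 : σ₂ x₀ ≠ p1 (!b) := fun h => by
    have h2 := hσfst x₀; rw [h, hfst1] at h2; omega
  have hd₂ : Disjoint (G₂.map σ₂) {σ₂ x₀, p1 (!b)} := by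
    rw [Finset.disjoint_left]
    intro z hz hz'
    obtain ⟨w, hw, rfl⟩ := Finset.mem_map.1 hz
    simp only [Finset.mem_insert, Finset.mem_singleton] at hz'
    rcases hz' with h | h
    · exact hx₂ (by rw [← σ₂.injective h]; exact hw)
    · have h2 := hσfst w; rw [h, hfst1] at h2; omega
  have hS₂ : IsSixPartS vP (!b) (G₂.map σ₂ ∪ {σ₂ x₀, p1 (!b)}) := by
    refine ⟨?_, ?_, fun a => ?_⟩
    · rw [Finset.card_union_of_disjoint hd₂, Finset.card_map, hW₂.1, Finset.card_pair hx₀p1]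
    · have hF : ∀ z ∈ G₂.map σ₂, ¬ vP z = Sum.inl (!b) := fun z hz => by
        obtain ⟨w, hw, rfl⟩ := Finset.mem_map.1 hz
        obtain ⟨a, ha⟩ := hW₂.exists_eq hw
        change vP (σ₂ w) ≠ _
        rw [hvσ, show v w = Sum.inr (Sum.inr (a, !b)) from ha]
        exact Sum.inr_ne_inl
      have hTr : ∀ z ∈ ({σ₂ x₀, p1 (!b)} : Finset IP), vP z = Sum.inl (!b) := fun z hz => by
        simp only [Finset.mem_insert, Finset.mem_singleton] at hz
        rcases hz with rfl | rfl
        · rw [hvσ]; exact hvx₀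
        · exact hv1 (!b)
      rw [Finset.filter_union, Finset.filter_false_of_mem hF, Finset.empty_union, Finset.filter_true_of_mem hTr,
        Finset.card_pair hx₀p1]
    · have hF : ∀ z ∈ ({σ₂ x₀, p1 (!b)} : Finset IP), ¬ vP z = Sum.inr (Sum.inr (a, !b)) := fun z hz => by
        simp only [Finset.mem_insert, Finset.mem_singleton] at hz
        rcases hz with rfl | rfl
        · rw [hvσ, show v x₀ = _ from hvx₀]; exact Sum.inl_ne_inr
        · rw [show vP (p1 (!b)) = _ from hv1 (!b)]; exact Sum.inl_ne_inr
      rw [Finset.filter_union, Finset.filter_false_of_mem hF, Finset.union_empty, Finset.filter_map, Finset.card_map, ← hW₂.2 a]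
      exact congrArg Finset.card (Finset.filter_congr fun w _ => by rw [Function.comp_apply, hvσ])
  have hS₁₂ : Disjoint (G₁.map σ₂ ∪ {p0 b}) (G₂.map σ₂ ∪ {σ₂ x₀, p1 (!b)}) := by
    rw [Finset.disjoint_union_left, Finset.disjoint_union_right, Finset.disjoint_union_right]
    refine ⟨⟨(Finset.disjoint_map σ₂).2 hG₁₂, ?_⟩, ?_, ?_⟩
    · rw [Finset.disjoint_left]
      intro z hz hz'
      obtain ⟨w, hw, rfl⟩ := Finset.mem_map.1 hz
      simp only [Finset.mem_insert, Finset.mem_singleton] at hz'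
      rcases hz' with h | h
      · exact hx₁ (by rw [← σ₂.injective h]; exact hw)
      · have h2 := hσfst w; rw [h, hfst1] at h2; omega
    · rw [Finset.disjoint_singleton_left]
      intro hz
      obtain ⟨w, -, hw⟩ := Finset.mem_map.1 hz
      have h2 := hσfst w
      rw [hw, hfst0] at h2; omega
    · rw [Finset.disjoint_left]
      intro z hz hz'
      rw [Finset.mem_singleton] at hz
      subst hz
      simp only [Finset.mem_insert, Finset.mem_singleton] at hz'
      rcases hz' with h | h
      · have h2 := hσfst x₀; rw [← h, hfst0] at h2; omega
      · exact hne01 _ _ h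
  have hunion : G.map σ₂ ∪ T = (G₁.map σ₂ ∪ {p0 b}).disjUnion (G₂.map σ₂ ∪ {σ₂ x₀, p1 (!b)}) hS₁₂ := by
    rw [Finset.disjUnion_eq_union, hGU, Finset.map_insert, Finset.map_union, hT]
    ext z
    simp only [Finset.mem_union, Finset.mem_insert, Finset.mem_singleton]
    tauto
  have halg₁ : weightClassesAlg (fun l => A (ext₂ κ l)) (fun l => ι (ext₂ κ l)) (2 * (4 + 1)) (G.map σ₂ ∪ T) ≤
      algebraicClasses (⨁ fun l => A (ext₂ κ l)).X (4 + 1) := by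
    rw [hunion]
    exact weightClassesAlg_union_le_algebraicClasses hAP (a := 2) (b := 3) (p := 4 + 1) rfl hS₁.1 hS₂.1 hS₁₂
      (hfour b _ hS₁) (hsix (!b) _ hS₂)
  -- ### push-pull
  exact weightClassesAlg_le_algebraicClasses_of_pushforward (A := fun l => A (ext₂ κ l))
    (Φ := fun l => Φ (ext₂ κ l)) (ι := fun l => ι (ext₂ κ l)) (θ := fun l => θ (ext₂ κ l)) hAP e₂' he₂'
    (p := 4) (q := 1) (r := 1) hGcard hTcard hT'card hTT' hcov halg₁ halg₂

end Eightfold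

end Summit.HodgeConjecture.CorCM.SexticOcticWeil

end
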